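import Mathlib
import Summits.Ventures.PercRepro2.TypedBundleSepTwo
import Summits.Ventures.PercRepro2.TypedPocketA1BTheorem

/-!
# The domain of record without the (HARRIS-1) o-pocket classes (blind cell PercRepro2, p2 g7,
2026-08-26; sub-claim S1 — p3 g7/g8's (HARRIS-1) class composed on the sixteen-condition layer; the
lead's RULING 1 (ii) of 00:44:30Z, R-SEP3(6))

p3 g8's `PocketA1B.typedCount_nonneg_of_hasPocketA1B` (the doors `a₁, b` separate `o` from `{a₂, a₃}` —
the o-pocket on the root `a₁` and the mark `b`; the typed-Harris-with-spectator certificate on the 5 × 15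
side decomposition) and its root mirror `typedCount_nonneg_of_hasPocketA1B_mirror` (the doors `a₂, b`),
composed in the `by_cases` pattern of every layer:

* **`ResidualCoreNHatCTBRASUDO7SP2H1 := ResidualCoreNHatCTBRASUDO7SP2 ∧ ¬HasPocketA1B ∧
  ¬HasPocketA1B(roots swapped)`**, **`HCov_all_of_residualCoreNHatCTBRASUDO7SP2H1_all`**;
* the flat form **`FlatDomain7SP2H1_all`** (eighteen conditions), **`HCov_all_of_flat7SP2H1_all`** —
  UNCONDITIONAL.

Own code; standard axioms.
-/

namespace Summit.Ventures.PercRepro2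

open UnionCluster

namespace CovForm

namespace TypedRed

section CoreHarris

variable {V : Type*} {E : Type*} [DecidableEq V] [Fintype E] [DecidableEq E]

/-- **The domain of record without the (HARRIS-1) o-pocket classes** (doors `{a₁, b}` and `{a₂, b}`). -/
structure ResidualCoreNHatCTBRASUDO7SP2H1 (ends : E → Sym2 V) (o a₁ a₂ a₃ b : V) (F : Finset E) :
    Prop where
  coreNHatCTBRASUDO7SP2 : ResidualCoreNHatCTBRASUDO7SP2 ends o a₁ a₂ a₃ b F
  not_pocketA1B : ¬ PocketA1B.HasPocketA1B ends o a₁ a₂ a₃ b F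
  not_pocketA1B_mirror : ¬ PocketA1B.HasPocketA1B ends o a₂ a₁ a₃ b F

end CoreHarris

section ClosureHarris

variable (R : Type*) [Field R] [LinearOrder R] [IsStrictOrderedRing R]

/-- **Row 2′TRI on `ResidualCoreNHatCTBRASUDO7SP2H1`, over every finite graph.** -/
def ResidualCoreNHatCTBRASUDO7SP2H1_all : Prop :=
  ∀ (V E : Type) [Fintype V] [DecidableEq V] [Fintype E] [DecidableEq E]
    (ends : E → Sym2 V) (o a₁ a₂ a₃ b : V) (F : Finset E) (τ : E → ℕ),
    (∀ e ∈ F, τ e = 1 ∨ τ e = 2) → ResidualCoreNHatCTBRASUDO7SP2H1 ends o a₁ a₂ a₃ b F →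
      0 ≤ typedCount F (fun _ => false) τ
        (K3 ends o a₁ a₂ a₃ b : Config E → Config E → Config E → R)

/-- **THE CRUX OF RECORD FROM (TRI) ON THE DOMAIN WITHOUT THE (HARRIS-1) CLASSES** — unconditional. -/
theorem HCov_all_of_residualCoreNHatCTBRASUDO7SP2H1_all
    (hc : ResidualCoreNHatCTBRASUDO7SP2H1_all R) : HCov_all R := by
  refine HCov_all_of_residualCoreNHatCTBRASUDO7SP2_all R ?_
  intro V E _ _ _ _ ends o a₁ a₂ a₃ b F τ hτ hdom
  by_cases hp : PocketA1B.HasPocketA1B ends o a₁ a₂ a₃ b F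
  · exact PocketA1B.typedCount_nonneg_of_hasPocketA1B ends o a₁ a₂ a₃ b F τ hτ hp
  by_cases hp' : PocketA1B.HasPocketA1B ends o a₂ a₁ a₃ b F
  · exact PocketA1B.typedCount_nonneg_of_hasPocketA1B_mirror ends o a₁ a₂ a₃ b F τ hτ hp'
  exact hc V E ends o a₁ a₂ a₃ b F τ hτ ⟨hdom, hp, hp'⟩

/-- **Row 2′TRI on the flat domain without the (HARRIS-1) classes, over every finite graph**
(eighteen conditions). -/
def FlatDomain7SP2H1_all : Prop :=
  ∀ (V E : Type) [Fintype V] [DecidableEq V] [Fintype E] [DecidableEq E]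
    (ends : E → Sym2 V) (o a₁ a₂ a₃ b : V) (F : Finset E) (τ : E → ℕ),
    (∀ e ∈ F, τ e = 1 ∨ τ e = 2) →
    ResidualCore ends o a₁ a₂ a₃ b F →
    ¬ Hats ends o a₁ a₂ a₃ b F →
    ¬ HasRootCut ends o a₁ a₂ a₃ b F →
    ¬ HasTwoTerminalPart ends o a₁ a₂ a₃ b F →
    ¬ HasRootBundle ends o a₁ a₂ a₃ b F →
    ¬ RootBridge.HasCutRoots ends o a₁ a₂ a₃ b F →
    ¬ RootBridge.HasCutRootsA3 ends o a₁ a₂ a₃ b F →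
    ¬ OneStar ends o a₁ a₂ a₃ b F →
    ¬ RootBridge.MildInst ends o a₁ a₂ a₃ b F (fun _ => false) →
    o ≠ b →
    ¬ RootBridge.OBehindA3 ends o a₁ a₂ a₃ F (fun _ => false) →
    7 ≤ F.card →
    ¬ SepThree.HasSepThree ends o a₁ a₂ a₃ b F →
    ¬ SepThree.HasSepThree ends o a₂ a₁ a₃ b F →
    ¬ PocketAB.HasPocketAB ends o a₁ a₂ a₃ b F →
    ¬ SepTwo.HasSepTwo ends o a₁ a₂ a₃ b F →
    ¬ PocketA1B.HasPocketA1B ends o a₁ a₂ a₃ b F →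
    ¬ PocketA1B.HasPocketA1B ends o a₂ a₁ a₃ b F →
      0 ≤ typedCount F (fun _ => false) τ
        (K3 ends o a₁ a₂ a₃ b : Config E → Config E → Config E → R)

/-- **THE CRUX OF RECORD FROM (TRI) ON THE FLAT DOMAIN WITHOUT THE (HARRIS-1) CLASSES** — the
sentence of record in one statement, eighteen conditions. -/
theorem HCov_all_of_flat7SP2H1_all (hc : FlatDomain7SP2H1_all R) : HCov_all R := by
  refine HCov_all_of_residualCoreNHatCTBRASUDO7SP2H1_all R ?_
  intro V E _ _ _ _ ends o a₁ a₂ a₃ b F τ hτ hdom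
  obtain ⟨h0, h1, h2, h3, h4, h5, h6, h7, h8, h9, h10⟩ :=
    (ResidualCoreNHatCTBRASUDO_iff ends o a₁ a₂ a₃ b F).1
      hdom.coreNHatCTBRASUDO7SP2.coreNHatCTBRASUDO7SP.coreNHatCTBRASUDO7S.coreNHatCTBRASUDO7.coreNHatCTBRASUDO
  exact hc V E ends o a₁ a₂ a₃ b F τ hτ h0 h1 h2 h3 h4 h5 h6 h7 h8 h9 h10
    hdom.coreNHatCTBRASUDO7SP2.coreNHatCTBRASUDO7SP.coreNHatCTBRASUDO7S.coreNHatCTBRASUDO7.seven_le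
    hdom.coreNHatCTBRASUDO7SP2.coreNHatCTBRASUDO7SP.coreNHatCTBRASUDO7S.not_sepThree
    hdom.coreNHatCTBRASUDO7SP2.coreNHatCTBRASUDO7SP.coreNHatCTBRASUDO7S.not_sepThree_mirror
    hdom.coreNHatCTBRASUDO7SP2.coreNHatCTBRASUDO7SP.not_pocketAB
    hdom.coreNHatCTBRASUDO7SP2.not_sepTwo hdom.not_pocketA1B hdom.not_pocketA1B_mirror

end ClosureHarris

end TypedRed

end CovForm

end Summit.Ventures.PercRepro2
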